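import Mathlib.Data.Nat.Digits.Defs
import Literature.Computability.AlgebraicComplexity.GCTObstructions
import Literature.RepresentationTheory.GeneralLinear.OrbitLatticeStability
import HarnessLib

/-!
# Weight probes on the coordinate ring of `Sym^m` and classes of degree-`d` forms

Third file of the `hyperalgebraCoinvariants` cluster (route ValiantsHypothesis/IntegralGCT): tools
for the monotonicity of the torsion ranks `d_p(f; d, λ)` (`OrbitLatticeMonotonicity.lean`).

* `digits_injective`: base-`B` expansions with digits `< B` are unique.
* `diagGL`, `weightProbe B c` (the element of `GL_σ` whose inverse is `diag(c^{B^{r(i)}})` for an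
  enumeration `r` of `σ`), `probeWeight`: the probe scales `X_d` by `c^{Σ_i d_i B^{r(i)}}`
  (`coordSubst_weightProbe_X`, `_monomial`) and `π_B(c) · F = Σ_l c^l F_{(l)}` with `F_{(l)}` the
  component of probe weight `l` (`coordSubst_weightProbe_eq_sum`).
* `digitVec`, `weight_probeWeight_eq`, `weight_coordWeight_eq`, `digitVec_le`: on degree-`d`
  coordinate monomials and for `B > m·d` the probe weight determines the weight
  (`weight_coordWeight_eq_of_probeWeight_eq`), so probe components of degree-`d` forms are weight
  components (`weightedHomogeneousComponent_probeWeight_eq`).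
* `toDeg f m d : k[V]_d → k[Δ f]_d` (classes of degree-`d` forms, onto) and the action on classes
  (`orbitCoordRepDeg_toDeg`).

All [folklore]: one-parameter torus elements separate finitely many weights over an infinite field.
-/

noncomputable section

namespace Literature.RepresentationTheory.GeneralLinear

open MvPolynomial Literature.Computability.AlgebraicComplexity
open scoped Polynomial

/-! ### Diagonal probes: separating weights by one-parameter torus elements -/

section Digits

/-- Base-`B` value of a `Fin`-indexed digit vector as `Nat.ofDigits` of its list of digits.
[folklore] -/
theorem ofDigits_ofFn_eq_sum (B : ℕ) : ∀ {N : ℕ} (u : Fin N → ℕ),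
    Nat.ofDigits B (List.ofFn u) = ∑ i, u i * B ^ (i : ℕ)
  | 0, u => by simp
  | N + 1, u => by
    rw [List.ofFn_succ, Nat.ofDigits_cons, ofDigits_ofFn_eq_sum B (fun i => u i.succ),
      Fin.sum_univ_succ]
    simp only [Fin.val_zero, pow_zero, mul_one, Fin.val_succ, pow_succ, Finset.mul_sum]
    congr 1
    exact Finset.sum_congr rfl fun i _ => by ring

/-- Base-`B` digit expansions with digits `< B` are unique — the `Fin`-indexed form of Mathlib's
`Nat.ofDigits_inj_of_len_eq` (via `ofDigits_ofFn_eq_sum`; for `B ≤ 1` all digits vanish).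
Same statement as `Literature.AlgebraicGeometry.Resolution.eq_of_sum_mul_pow_eq`, which is not
imported to keep the GCT import cone small. [folklore] -/
theorem digits_injective {N B : ℕ} (u v : Fin N → ℕ) (hu : ∀ i, u i < B) (hv : ∀ i, v i < B)
    (h : ∑ i, u i * B ^ (i : ℕ) = ∑ i, v i * B ^ (i : ℕ)) : u = v := by
  rcases le_or_gt B 1 with hB | hB
  · funext i
    have h1 : u i < 1 := (hu i).trans_le hB
    have h2 : v i < 1 := (hv i).trans_le hB
    omega
  · rw [← ofDigits_ofFn_eq_sum, ← ofDigits_ofFn_eq_sum] at h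
    exact List.ofFn_injective (Nat.ofDigits_inj_of_len_eq hB (by simp)
      (List.forall_mem_ofFn_iff.2 hu) (List.forall_mem_ofFn_iff.2 hv) h)

end Digits

section Probe

variable {σ : Type*} [Fintype σ] [DecidableEq σ] {R : Type*} [CommRing R]

/-- The diagonal element of `GL_σ(R)` with unit entries `w` (any commutative ring `R`; the
tree's `Literature.NumberTheory.Automorphic.diagonalGL` is the same object over a field).
[folklore] -/
def diagGL (w : σ → Rˣ) : GL σ R :=
  ⟨Matrix.diagonal fun i => (w i : R), Matrix.diagonal fun i => ((w i)⁻¹ : Rˣ),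
    by rw [Matrix.diagonal_mul_diagonal, ← Matrix.diagonal_one]; simp,
    by rw [Matrix.diagonal_mul_diagonal, ← Matrix.diagonal_one]; simp⟩

/-- The matrix of `diagGL`. [folklore] -/
@[simp] theorem coe_diagGL (w : σ → Rˣ) :
    ((diagGL w : GL σ R) : Matrix σ σ R) = Matrix.diagonal fun i => (w i : R) := rfl

omit [DecidableEq σ] in
/-- A diagonal matrix scales each variable. [folklore] -/
theorem linSubst_diagonal_X [DecidableEq σ] (v : σ → R) (i : σ) :
    linSubst σ R (Matrix.diagonal v) (X i) = v i • X i := by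
  rw [linSubst_X, Finset.sum_eq_single i
    (fun j _ hj => by rw [Matrix.diagonal_apply_ne _ hj, zero_smul])
    (fun h => absurd (Finset.mem_univ i) h), Matrix.diagonal_apply_eq]

/-- A diagonal matrix scales each monomial `x^e` by `Π v_i^{e_i}`. [folklore] -/
theorem linSubst_diagonal_monomial (v : σ → R) (e : σ →₀ ℕ) (a : R) :
    linSubst σ R (Matrix.diagonal v) (monomial e a) =
      (e.prod fun i k => v i ^ k) • monomial e a := by
  rw [monomial_eq, map_mul, linSubst_C, Finsupp.prod, Finsupp.prod, map_prod, smul_eq_C_mul,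
    map_prod,
    ← mul_assoc, mul_comm (∏ _ ∈ _, _) (C a), mul_assoc, ← Finset.prod_mul_distrib]
  refine congrArg (C a * ·) (Finset.prod_congr rfl fun i _ => ?_)
  rw [map_pow, linSubst_diagonal_X, smul_eq_C_mul, mul_pow, map_pow]

/-- The **weight probe** `π_B(c) ∈ GL_σ(R)`: the element whose INVERSE is the diagonal matrix
`diag(c^{B^{r(i)}})` for a fixed enumeration `r : σ ≃ Fin N`. Acting by `coordSubst` it scales
the coordinate `X_d` by `c^{Σ_i d_i B^{r(i)}}`; for `B` larger than all digits this exponent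
determines the weight, so one-variable Vandermonde arguments separate weight components.
[folklore] -/
def weightProbe (B : ℕ) (c : Rˣ) : GL σ R :=
  (diagGL fun i => c ^ B ^ (Fintype.equivFin σ i : ℕ))⁻¹

/-- The probe exponent of a coordinate `X_d`: `Σ_i d_i B^{r(i)}`. [folklore] -/
def probeWeight (B m : ℕ) (d : DegIdx σ m) : ℕ :=
  ∑ i, d.1 i * B ^ (Fintype.equivFin σ i : ℕ)

/-- The probe scales `X_d` by `c^{probeWeight d}`. [folklore] -/
theorem coordSubst_weightProbe_X (m B : ℕ) (c : Rˣ) (d : DegIdx σ m) :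
    coordSubst m (weightProbe B c) (X d) = ((c : R) ^ probeWeight B m d) • X d := by
  have hlin : ∀ e : DegIdx σ m, linSubstRep σ R (weightProbe B c)⁻¹ (monomial e.1 (1 : R)) =
      (e.1.prod fun i k => ((c : R) ^ B ^ (Fintype.equivFin σ i : ℕ)) ^ k) • monomial e.1 1 := by
    intro e
    rw [weightProbe, inv_inv, linSubstRep_apply, coe_diagGL, linSubst_diagonal_monomial]
    simp only [Units.val_pow_eq_pow_val]
  rw [coordSubst_X, Finset.sum_eq_single d]
  · rw [hlin, coeff_smul, coeff_monomial, if_pos rfl, smul_eq_mul, mul_one,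
      Finsupp.prod_fintype _ _ (fun i => pow_zero _)]
    simp only [← pow_mul, Finset.prod_pow_eq_pow_sum, probeWeight]
    simp_rw [mul_comm (B ^ _) (d.1 _)]
  · intro e _ hne
    rw [hlin, coeff_smul, coeff_monomial, if_neg (fun h => hne (Subtype.ext h)), smul_zero,
      zero_smul]
  · exact fun h => absurd (Finset.mem_univ d) h

/-- The probe scales a coordinate monomial `Π X_d^{n_d}` by `c^{Σ n_d · probeWeight d}`.
[folklore] -/
theorem coordSubst_weightProbe_monomial (m B : ℕ) (c : Rˣ) (n : DegIdx σ m →₀ ℕ) (a : R) :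
    coordSubst m (weightProbe B c) (monomial n a) =
      ((c : R) ^ Finsupp.weight (probeWeight B m) n) • monomial n a := by
  have hX : ∀ (d : DegIdx σ m) (k : ℕ), coordSubst m (weightProbe B c) (X d ^ k) =
      C ((c : R) ^ (probeWeight B m d * k)) * X d ^ k := by
    intro d k
    rw [map_pow, coordSubst_weightProbe_X, smul_eq_C_mul, mul_pow, ← map_pow, ← pow_mul]
  have hC : coordSubst m (weightProbe B c) (C a) = C a :=
    (coordSubst m (weightProbe (σ := σ) B c)).commutes a
  rw [monomial_eq, map_mul, hC, Finsupp.prod, map_prod]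
  simp_rw [hX]
  rw [Finset.prod_mul_distrib, ← map_prod, Finset.prod_pow_eq_pow_sum, smul_eq_C_mul, mul_left_comm,
    Finsupp.weight_apply, Finsupp.sum]
  simp_rw [smul_eq_mul, mul_comm (n _) (probeWeight B m _)]

/-- Expansion of the probe action in powers of `c`: `π_B(c) · F = Σ_l c^l • F_{(l)}`, where
`F_{(l)}` is the component of `F` of probe weight `l`. [folklore] -/
theorem coordSubst_weightProbe_eq_sum (m B : ℕ) (c : Rˣ) (F : MvPolynomial (DegIdx σ m) R)
    {D : ℕ} (hD : ∀ n ∈ F.support, Finsupp.weight (probeWeight B m) n ≤ D) :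
    coordSubst m (weightProbe B c) F =
      ∑ l ∈ Finset.range (D + 1),
        ((c : R) ^ l) • weightedHomogeneousComponent (probeWeight B m) l F := by
  classical
  conv_lhs => rw [F.as_sum, map_sum]
  simp_rw [coordSubst_weightProbe_monomial, weightedHomogeneousComponent_apply, Finset.smul_sum,
    Finset.sum_filter]
  rw [Finset.sum_comm]
  refine Finset.sum_congr rfl fun n hn => ?_
  rw [Finset.sum_ite_eq, if_pos (Finset.mem_range.2 (Nat.lt_succ_of_le (hD n hn)))]

end Probe

end Literature.RepresentationTheory.GeneralLinear

namespace Literature.RepresentationTheory.GeneralLinear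

open MvPolynomial Literature.Computability.AlgebraicComplexity Representation
open scoped Polynomial

section DigitVec

variable {σ : Type*} [Fintype σ] [DecidableEq σ]

/-- The digit vector of a coordinate monomial `Π X_e^{n_e}`: `δ(n)_i = Σ_e n_e e_i` (so that its
weight is `-δ(n)` and its probe exponent is `Σ_i δ(n)_i B^{r(i)}`). [folklore] -/
def digitVec (m : ℕ) (n : DegIdx σ m →₀ ℕ) (i : σ) : ℕ :=
  ∑ e ∈ n.support, n e * e.1 i

/-- The probe exponent of a monomial is the base-`B` number with digits `δ(n)`. [folklore] -/
theorem weight_probeWeight_eq (B m : ℕ) (n : DegIdx σ m →₀ ℕ) :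
    Finsupp.weight (probeWeight B m) n = ∑ i, digitVec m n i * B ^ (Fintype.equivFin σ i : ℕ) := by
  rw [Finsupp.weight_apply, Finsupp.sum]
  simp only [smul_eq_mul, probeWeight, Finset.mul_sum, digitVec, Finset.sum_mul]
  rw [Finset.sum_comm]
  refine Finset.sum_congr rfl fun i _ => Finset.sum_congr rfl fun e _ => by ring

/-- The weight of a monomial is minus its digit vector. [folklore] -/
theorem weight_coordWeight_eq (m : ℕ) (n : DegIdx σ m →₀ ℕ) :
    Finsupp.weight (coordWeight m) n = fun i => -(digitVec m n i : ℤ) := by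
  rw [Finsupp.weight_apply, Finsupp.sum]
  funext i
  rw [Finset.sum_apply]
  simp only [Pi.smul_apply, coordWeight_apply, nsmul_eq_mul, digitVec, Nat.cast_sum, Nat.cast_mul,
    ← Finset.sum_neg_distrib, mul_neg]

/-- Digits of degree-`d'` coordinate monomials are at most `m · d'`. [folklore] -/
theorem digitVec_le (m : ℕ) {d' : ℕ} {n : DegIdx σ m →₀ ℕ}
    (hn : Finsupp.weight (1 : DegIdx σ m → ℕ) n = d') (i : σ) : digitVec m n i ≤ m * d' := by
  have hdeg : ∑ e ∈ n.support, n e = d' := by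
    rw [← hn, Finsupp.weight_apply, Finsupp.sum]
    simp
  calc digitVec m n i = ∑ e ∈ n.support, n e * e.1 i := rfl
    _ ≤ ∑ e ∈ n.support, n e * m := Finset.sum_le_sum fun e _ => Nat.mul_le_mul_left _
        ((Finsupp.le_degree i e.1).trans (mem_degMonomials_iff.1 e.2).le)
    _ = m * d' := by rw [← Finset.sum_mul, hdeg, mul_comm]

/-- For two coordinate monomials of the same degree `d'` and `B > m · d'`, equal probe exponents
force equal weights (base-`B` digits are unique). [folklore] -/
theorem weight_coordWeight_eq_of_probeWeight_eq (m : ℕ) {d' B : ℕ} (hB : m * d' < B)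
    {n n' : DegIdx σ m →₀ ℕ} (hn : Finsupp.weight (1 : DegIdx σ m → ℕ) n = d')
    (hn' : Finsupp.weight (1 : DegIdx σ m → ℕ) n' = d')
    (h : Finsupp.weight (probeWeight B m) n = Finsupp.weight (probeWeight B m) n') :
    Finsupp.weight (coordWeight m) n = Finsupp.weight (coordWeight m) n' := by
  rw [weight_probeWeight_eq, weight_probeWeight_eq] at h
  set r := Fintype.equivFin σ with hr
  have h' : ∑ j : Fin (Fintype.card σ), digitVec m n (r.symm j) * B ^ (j : ℕ) =
      ∑ j : Fin (Fintype.card σ), digitVec m n' (r.symm j) * B ^ (j : ℕ) := by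
    rw [← Equiv.sum_comp r.symm, ← Equiv.sum_comp r.symm] at h
    simpa only [Equiv.apply_symm_apply] using h
  have hδ := digits_injective _ _ (fun j => (digitVec_le m hn _).trans_lt hB)
    (fun j => (digitVec_le m hn' _).trans_lt hB) h'
  rw [weight_coordWeight_eq, weight_coordWeight_eq]
  funext i
  have := congrFun hδ (r i)
  simp only [Equiv.symm_apply_apply] at this
  rw [this]

/-- Conversely equal weights give equal probe exponents. [folklore] -/
theorem probeWeight_eq_of_weight_coordWeight_eq (B m : ℕ) {n n' : DegIdx σ m →₀ ℕ}
    (h : Finsupp.weight (coordWeight m) n = Finsupp.weight (coordWeight m) n') :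
    Finsupp.weight (probeWeight B m) n = Finsupp.weight (probeWeight B m) n' := by
  rw [weight_coordWeight_eq, weight_coordWeight_eq] at h
  have hδ : digitVec m n = digitVec m n' := by
    funext i
    have := congrFun h i
    simp only [neg_inj, Nat.cast_inj] at this
    exact this
  rw [weight_probeWeight_eq, weight_probeWeight_eq, hδ]

variable {R : Type*} [CommRing R]

/-- On a homogeneous coordinate form of degree `d'`, the probe component at the probe exponent of
a degree-`d'` monomial `n₀` (for `B > m · d'`) is the weight component of weight `wt(n₀)`.
[folklore] -/
theorem weightedHomogeneousComponent_probeWeight_eq (m : ℕ) {d' B : ℕ} (hB : m * d' < B)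
    {G : MvPolynomial (DegIdx σ m) R} (hG : G.IsHomogeneous d') {n₀ : DegIdx σ m →₀ ℕ}
    (hn₀ : Finsupp.weight (1 : DegIdx σ m → ℕ) n₀ = d') :
    weightedHomogeneousComponent (probeWeight B m) (Finsupp.weight (probeWeight B m) n₀) G =
      weightedHomogeneousComponent (coordWeight m) (Finsupp.weight (coordWeight m) n₀) G := by
  classical
  ext n
  rw [coeff_weightedHomogeneousComponent, coeff_weightedHomogeneousComponent]
  by_cases hc : coeff n G = 0
  · simp only [hc, ite_self]
  have hn : Finsupp.weight (1 : DegIdx σ m → ℕ) n = d' := hG hc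
  by_cases hw : Finsupp.weight (coordWeight m) n = Finsupp.weight (coordWeight m) n₀
  · rw [if_pos hw, if_pos (probeWeight_eq_of_weight_coordWeight_eq B m hw)]
  · rw [if_neg hw, if_neg fun h => hw (weight_coordWeight_eq_of_probeWeight_eq m hB hn hn₀ h)]

/-- Weight components of homogeneous forms are homogeneous. [folklore] -/
theorem isHomogeneous_weightedHomogeneousComponent {m : ℕ} {M : Type*} [AddCommMonoid M]
    (w : DegIdx σ m → M) (l : M) {d' : ℕ} {F : MvPolynomial (DegIdx σ m) R}
    (hF : F.IsHomogeneous d') :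
    (weightedHomogeneousComponent w l F).IsHomogeneous d' := by
  classical
  intro n hn
  rw [coeff_weightedHomogeneousComponent] at hn
  split_ifs at hn with h
  · exact hF hn
  · exact absurd rfl hn

/-- Weight components commute with change of scalars. [folklore] -/
theorem map_weightedHomogeneousComponent {m : ℕ} {S : Type*} [CommRing S] {M : Type*}
    [AddCommMonoid M] (w : DegIdx σ m → M) (l : M) (φ : R →+* S)
    (F : MvPolynomial (DegIdx σ m) R) :
    map φ (weightedHomogeneousComponent w l F) = weightedHomogeneousComponent w l (map φ F) := by
  classical
  ext n
  rw [coeff_map, coeff_weightedHomogeneousComponent, coeff_weightedHomogeneousComponent, coeff_map]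
  split_ifs <;> simp

end DigitVec

/-! ### Classes of degree-`d` forms and what intertwiners do to components -/

section ToDeg

variable {σ : Type*} [Fintype σ] [DecidableEq σ] {k : Type*} [Field k]

/-- The class in `k[Δ f]_d` of a degree-`d` coordinate form, as a `k`-linear map
`k[V]_d → k[Δ f]_d`. [cite: BurgisserIkenmeyerPanova2019, §1] -/
def toDeg (f : MvPolynomial σ k) (m d : ℕ) :
    homogeneousSubmodule (DegIdx σ m) k d →ₗ[k] orbitCoordRingDeg f m d :=
  (Ideal.Quotient.mkₐ k (orbitVanishingIdeal f m)).toLinearMap.restrict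
    fun _ hF => Submodule.mem_map_of_mem hF

/-- `toDeg` on representatives. [folklore] -/
@[simp] theorem coe_toDeg (f : MvPolynomial σ k) (m d : ℕ)
    (F : homogeneousSubmodule (DegIdx σ m) k d) :
    ((toDeg f m d F : orbitCoordRingDeg f m d) : OrbitCoordRing f m) =
      Ideal.Quotient.mk (orbitVanishingIdeal f m) (F : MvPolynomial (DegIdx σ m) k) := rfl

/-- `toDeg` is onto `k[Δ f]_d`. [folklore] -/
theorem toDeg_surjective (f : MvPolynomial σ k) (m d : ℕ) : Function.Surjective (toDeg f m d) := by
  rintro ⟨x, hx⟩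
  obtain ⟨F, hF, rfl⟩ := mem_orbitCoordRingDeg_iff.1 hx
  exact ⟨⟨F, (mem_homogeneousSubmodule d F).2 hF⟩, rfl⟩

/-- The `GL`-action on classes of forms: `g · [F] = [g · F]`. [folklore] -/
theorem orbitCoordRepDeg_toDeg (f : MvPolynomial σ k) (m d : ℕ) (g : GL σ k)
    (F : homogeneousSubmodule (DegIdx σ m) k d) :
    orbitCoordRepDeg f m d g (toDeg f m d F) =
      toDeg f m d ⟨coordSubst m g F, (mem_homogeneousSubmodule d _).2
        (isHomogeneous_coordSubst g ((mem_homogeneousSubmodule d _).1 F.2))⟩ :=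
  Subtype.ext rfl

end ToDeg

end Literature.RepresentationTheory.GeneralLinear
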